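import Mathlib
import HarnessLib
import Literature.NumberTheory.LFunctions.KowalskiMichelHarmonicMoments
import Literature.NumberTheory.LFunctions.NewformRootNumberPrimeLevel

/-!
# Negative lemma (durable, statement-TEXT level): the typed Petersson fact
`KowalskiMichel2000.kowalskiMichel2000_petersson` is false as typed

Route-independent form of `PrimeLevelFamEdgePeterssonPrintedRefutation.lean` (refuter ls-ref-1 g6,
item stmt-Parity-20012 `PrimeLevelFamEdge.PeterssonPrinted := kowalskiMichel2000_petersson`): this file
imports NO Theses module, so it survives restatements of the route (director-frontier LESSON
2026-08-27: negative theorems over a route-item decl die at the next restate — state them over the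
statement text). Content: the typed fact quantifies over ALL `m, n ≥ 1`
(`‖Σʰ λ_f(m)λ_f(n) − δ(m,n)‖ ≤ C_ε (mn)^{1/2+ε} q^{-3/2}` at every prime level `q`, weight 2), but
Kowalski–Michel 2000 use it (p. 310, display after (16)) only in the mollifier range and derive it
(p. 312, (23)) under "since `(m, q) = 1`": Weil's bound carries `(m,n,c)^{1/2} ≥ q^{1/2}` on the moduli
`c ≡ 0 (q)` once `q ∣ m`, `q ∣ n`. Witness `m = n = q`: `λ_f(q)² = 1/q` for `f ∈ H_2(q)` (tree:
`IwaniecSarnak.heckeLambda_level_mul_sqrt_sq`), so `Σʰ λ_f(q)² = q⁻¹ Σʰ 1 ≈ 1/q` and the error at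
`(q,q)` is `≈ 1`, not `O(q^{2ε−1/2})`.

REPAIRED STATEMENT C′ (believed true = Petersson + Weil, uniformly in `m, n`; the witness misses it;
every tree consumer instantiates only `(1,1)`, `(q,1)` or indices `< q`, all inside C′):
`∀ ε : ℝ, 0 < ε → ∃ C : ℝ, ∀ (q : ℕ) [NeZero q], q.Prime → ∀ m n : ℕ, 1 ≤ m → 1 ≤ n →
  (m.gcd n).Coprime q → ‖pet q m n - (if m = n then 1 else 0)‖ ≤
    C * (((m : ℝ) * n) ^ (1 / 2 + ε)) * (q : ℝ) ^ (-(3 / 2 : ℝ))`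
(equivalently: keep all `m, n` and multiply the right side by `(((m.gcd n).gcd q : ℕ) : ℝ) ^ (1/2 : ℝ)`).
Consumers to migrate when the Literature def is repaired: `abs_pairSum_sub_delta_le`
(KMVMomentsToHalfEdge), `pairSum_bounds` (IwaniecSarnakFamilyAmplifiedEvenShare) restate the
unrestricted `∀ l m` and need the same binder; `masses_prime_weightTwo`, `abs_totalMass_sub_one_le`
(`(1,1)`), `abs_two_mul_evenMass_sub_totalMass_le` (`(q,1)`), `mollifierNormBound_of_petersson`
(`l, m ≤ q̂^{Δ'} < q`) get a `Nat.Coprime` side goal each. Until then every theorem with binder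
`(hP : kowalskiMichel2000_petersson)` is an implication from a false hypothesis.

WHAT THIS IS NOT: no claim against the printed estimate in its range, the family edge, or
Landau–Siegel zeros. «The programme SEARCHES and TYPES; no claim about Landau–Siegel zeros,
Theorems 1–2 of arXiv:2211.02515 or a repaired Margin232 until a kernel theorem says so.»
-/

namespace Summit.Parity.GeneralizedHardyLittlewood.Theorems.PeterssonPrinted.Negative

open Literature.NumberTheory.LFunctions
open Literature.NumberTheory.EllipticCurves.ModularForms

/-- The typed Kowalski–Michel Petersson estimate, quantified over ALL `m, n ≥ 1`, is false: witness
`m = n = q` at a large prime level `q` (`λ_f(q)² = 1/q`, so `Σʰ λ_f(q)² = q⁻¹ Σʰ 1 ≈ q⁻¹`, error `≈ 1`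
against the claimed `C q^{2ε−1/2}`, `ε = 1/8`, `q ≥ (4(|C|+1))⁴`). Repair: add the binder
`(m.gcd n).Coprime q →` (KM2000 p. 312 "since `(m,q) = 1`"). [cite: KowalskiMichel2000, §2.3 p. 310 (display after (16)) and p. 312 (23)] -/
theorem kowalskiMichel2000_petersson_false_allIndices :
    ¬ KowalskiMichel2000.kowalskiMichel2000_petersson := by
  intro h
  obtain ⟨C, hC⟩ := h (1 / 8) (by norm_num)
  -- a large prime level
  set K : ℝ := 4 * (|C| + 1) with hK
  have hC0 : 0 ≤ |C| := abs_nonneg C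
  have hK1 : 1 ≤ K := by rw [hK]; linarith
  have hKpos : 0 < K := by linarith
  obtain ⟨q, hqge, hq⟩ := Nat.exists_infinite_primes (⌈K ^ 4⌉₊ + 2)
  haveI : NeZero q := ⟨hq.ne_zero⟩
  -- Atkin–Lehner at the level: `Σʰ λ_f(q)λ_f(q) = q⁻¹ · Σʰ λ_f(1)λ_f(1)` (`λ_f(q)² q = 1`, `λ_f(1) = 1`)
  have hpet : KowalskiMichel2000.pet q q q = ((q : ℂ))⁻¹ * KowalskiMichel2000.pet q 1 1 := by
    unfold KowalskiMichel2000.pet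
    rw [← GL2Family.harmonicSum_const_mul]
    unfold GL2Family.harmonicSum
    refine finsum_mem_congr rfl fun f hf ↦ ?_
    have hf' : IsNewform0 f := hf
    have h1 : GL2Family.heckeLambda f 1 = 1 := GL2Family.heckeLambda_one_of_isNormalized hf'.2.2
    have hsq := IwaniecSarnak.heckeLambda_level_mul_sqrt_sq hq hf'
    have hsqrt : ((Real.sqrt q : ℝ) : ℂ) ^ 2 = (q : ℂ) := by
      rw [← Complex.ofReal_pow, Real.sq_sqrt (Nat.cast_nonneg q), Complex.ofReal_natCast]
    have h2 : GL2Family.heckeLambda f q ^ 2 * (q : ℂ) = 1 := by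
      rw [← hsqrt, ← mul_pow]; exact hsq
    have hl : GL2Family.heckeLambda f q * GL2Family.heckeLambda f q = ((q : ℂ))⁻¹ := by
      rw [← sq]; exact eq_inv_of_mul_eq_one_left h2
    simp only [h1, hl, mul_one]
  have hq1 : (1 : ℝ) ≤ q := by exact_mod_cast hq.one_lt.le
  have hqpos : (0 : ℝ) < q := by linarith
  have hqK4 : K ^ 4 ≤ (q : ℝ) := by
    have : (⌈K ^ 4⌉₊ : ℝ) ≤ q := by exact_mod_cast (by omega : ⌈K ^ 4⌉₊ ≤ q)
    exact (Nat.le_ceil _).trans this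
  have hqK : K ≤ (q : ℝ) := by
    calc K = K ^ 1 := (pow_one K).symm
      _ ≤ K ^ 4 := pow_le_pow_right₀ hK1 (by norm_num)
      _ ≤ q := hqK4
  -- the typed fact at (m,n) = (1,1) and at (m,n) = (q,q)
  have h11 := hC q hq 1 1 le_rfl le_rfl
  rw [if_pos rfl] at h11
  simp only [Nat.cast_one, mul_one, Real.one_rpow] at h11
  have hqq := hC q hq q q hq.one_lt.le hq.one_lt.le
  rw [if_pos rfl] at hqq
  -- exponent bookkeeping: (q·q)^{1/2+1/8} · q^{-3/2} = q^{-1/4} ≤ K⁻¹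
  have hXY : ((q : ℝ) * q) ^ ((1 / 2 : ℝ) + 1 / 8) * (q : ℝ) ^ (-(3 / 2 : ℝ)) =
      (q : ℝ) ^ (-(1 / 4 : ℝ)) := by
    rw [Real.mul_rpow hqpos.le hqpos.le, ← Real.rpow_add hqpos, ← Real.rpow_add hqpos]
    congr 1
    norm_num
  have hq14 : K ≤ (q : ℝ) ^ (1 / 4 : ℝ) := by
    have hmono : (K ^ 4) ^ (1 / 4 : ℝ) ≤ (q : ℝ) ^ (1 / 4 : ℝ) :=
      Real.rpow_le_rpow (by positivity) hqK4 (by norm_num)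
    have e : (K ^ 4) ^ (1 / 4 : ℝ) = K := by
      rw [← Real.rpow_natCast, ← Real.rpow_mul hKpos.le]
      norm_num
    rwa [e] at hmono
  have hneg : (q : ℝ) ^ (-(1 / 4 : ℝ)) ≤ K⁻¹ := by
    rw [Real.rpow_neg hqpos.le]
    exact inv_anti₀ hKpos hq14
  have hq32 : (q : ℝ) ^ (-(3 / 2 : ℝ)) ≤ 1 :=
    Real.rpow_le_one_of_one_le_of_nonpos hq1 (by norm_num)
  -- (A) the harmonic mass is bounded: ‖Σʰ 1‖ ≤ 1 + |C|
  have hA : ‖KowalskiMichel2000.pet q 1 1‖ ≤ 1 + |C| := by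
    have h0 := norm_le_insert' (KowalskiMichel2000.pet q 1 1) (1 : ℂ)
    rw [norm_one] at h0
    have : C * (q : ℝ) ^ (-(3 / 2 : ℝ)) ≤ |C| := by
      calc C * (q : ℝ) ^ (-(3 / 2 : ℝ)) ≤ |C| * (q : ℝ) ^ (-(3 / 2 : ℝ)) :=
            mul_le_mul_of_nonneg_right (le_abs_self C) (by positivity)
        _ ≤ |C| := mul_le_of_le_one_right hC0 hq32
    linarith
  -- (B) the typed error at (q,q) is small: ‖Σʰ λ_f(q)² − 1‖ ≤ |C| K⁻¹
  have hB : ‖KowalskiMichel2000.pet q q q - 1‖ ≤ |C| * K⁻¹ := by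
    have e1 : C * (((q : ℝ) * q) ^ ((1 / 2 : ℝ) + 1 / 8)) * (q : ℝ) ^ (-(3 / 2 : ℝ)) =
        C * (q : ℝ) ^ (-(1 / 4 : ℝ)) := by
      rw [mul_assoc, hXY]
    rw [e1] at hqq
    calc ‖KowalskiMichel2000.pet q q q - 1‖ ≤ C * (q : ℝ) ^ (-(1 / 4 : ℝ)) := hqq
      _ ≤ |C| * (q : ℝ) ^ (-(1 / 4 : ℝ)) :=
          mul_le_mul_of_nonneg_right (le_abs_self C) (by positivity)
      _ ≤ |C| * K⁻¹ := mul_le_mul_of_nonneg_left hneg hC0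
  -- (C) but Σʰ λ_f(q)² = q⁻¹ Σʰ 1 is small too
  have hCc : ‖KowalskiMichel2000.pet q q q‖ ≤ (1 + |C|) * K⁻¹ := by
    rw [hpet, norm_mul, norm_inv, Complex.norm_natCast]
    calc (q : ℝ)⁻¹ * ‖KowalskiMichel2000.pet q 1 1‖ ≤ (q : ℝ)⁻¹ * (1 + |C|) :=
          mul_le_mul_of_nonneg_left hA (by positivity)
      _ ≤ K⁻¹ * (1 + |C|) := mul_le_mul_of_nonneg_right (inv_anti₀ hKpos hqK) (by positivity)
      _ = (1 + |C|) * K⁻¹ := mul_comm _ _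
  -- triangle inequality: 1 ≤ ‖pet − 1‖ + ‖pet‖ < 1
  have htri : (1 : ℝ) ≤ ‖KowalskiMichel2000.pet q q q - 1‖ + ‖KowalskiMichel2000.pet q q q‖ := by
    have h0 := norm_le_insert' (1 : ℂ) (KowalskiMichel2000.pet q q q)
    rw [norm_one, norm_sub_rev] at h0
    linarith
  have hfin : |C| * K⁻¹ + (1 + |C|) * K⁻¹ < 1 := by
    rw [← add_mul, hK, ← div_eq_mul_inv, div_lt_one (by positivity)]
    linarith
  linarith

end Summit.Parity.GeneralizedHardyLittlewood.Theorems.PeterssonPrinted.Negative
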